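import Literature.MathematicalPhysics.QuantumFieldTheory.BalabanImbrieJaffe1984to88.BIJ88GaussIntegration309
import Mathlib.Analysis.Complex.Norm

/-!
# `BalabanImbrieJaffe1984to88.BIJ88GaussIntegration309Phi` — T. Bałaban, J. Imbrie, A. Jaffe, *Effective action and cluster properties
of the abelian Higgs model*, Commun. Math. Phys. **114** (1988) 257–315 [BalabanImbrieJaffe1988]: p. 309 [PDF 53] (Sect. 5.14, proof of
(5.14.4)), the clause *"Similar bounds hold for φ^{(k)}."* following *"After integration over A^{(k)}, we obtain factors ct^{−n}e^{−cp(te_k)²}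
≤ (e^β(L^kε/ε₀)^{1/4−α})ⁿ"* (p. 308: *"and similarly for χ(cp(e_k), φ^{(k)})"* — the same interpolated cutoff, with the complex scalar
fluctuation field in place of the real gauge field).

PROVED in two steps.  (1) `integral_abs_iteratedDeriv_cutoff_t_le_measureReal`: the p. 309 factor for an ARBITRARY law — for any finite
measure μ on a space Ω and any measurable real observable `Φ` (the quantity the cutoff restricts: `A^{(k)}(b)`, `|φ^{(k)}(x)|`, …),
`∫ |(d/dt)ⁿ χ(c·p(te_k), Φ(ω))| dμ(ω) ≤ C(χ,p,n)·t^{−n}·μ{(9/10)|c|p(te_k) ≤ |Φ|}` (n ≥ 1; from `BIJ88ChiTDerivN309`: the derivative is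
`≤ Ct^{−n}` and supported in the shell) — so only a TAIL BOUND of the law of Φ is ever needed.  (2) MODEL INSTANCE for φ^{(k)} (stated as
such): `φ = X + iY` with `X`, `Y` independent centered real Gaussians of variance `v` (Mathlib `(gaussianReal 0 v).prod (gaussianReal 0 v)`),
`Φ = |φ| = √(X² + Y²)` (`norm_mk_eq_sqrt`): the event `|φ| ≥ a` lies in `{|X| ≥ a/√2} ∪ {|Y| ≥ a/√2}` (`sqrt_sq_add_sq_tail_subset`), hence has
probability `≤ 4e^{−a²/(4v)}` (`gaussian2_real_norm_ge_le`, from the one-dimensional Chernoff tails of `BIJ88GaussIntegration309`), and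
`∫ |(d/dt)ⁿ χ(c·p(te_k), |φ|)| dγ ≤ (4C)/tⁿ · e^{−((81/400)c²/v)·p(te_k)²}` (`exists_integral_abs_iteratedDeriv_cutoff_t_phi_le`) — again the
printed `ct^{−n}e^{−cp(te_k)²}`, and `gauss309` carries it to `(e^β(L^kε/ε₀)^{1/4−α})ⁿ` (`exists_integral_phi_le_vertexFactor_pow`).

statement-level skeleton of published theorems with citation tags; proofs where landed; nothing here is a claim about the Yang–Mills mass gap

PDF held: `paper:balaban1988-cmp114-bij-abelian-higgs-effective-action` (journal page = PDF page + 256).  Pages read as images: PDF pp. 52–53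
(journal 308–309), `g4png.py` ×2 renders (seat folder `renders/original-p052-x2.png`, `original-p053-x2.png`).

CITATION HEADER (lean-in-tree rule).  Part of the lit-balaban TYPED SKELETON (HOME `run/shared/lean/pub/lit-balaban/`), Phase 2,
seat p36 (gen 5, unit `lit-balaban-p36`); row **C2.Eq5.14.3-5.14.4** of `HOME/lit-balaban-r16/ROWS-C2-part2.md`.  Theorems only; no
definitions, no `Prop` facts; axioms standard.
-/

namespace Literature.MathematicalPhysics.QuantumFieldTheory.BalabanImbrieJaffe1984to88.BIJ88GaussIntegration309Phi

open MeasureTheory ProbabilityTheory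
open BIJ88Sect2Statements (pLog eK)
open BIJ88Sect5Statements (CutoffProfile cutoff)
open BIJ88GaussIntegration309 (gaussianReal_real_abs_ge_le)
open scoped NNReal

/-! ## §1 The p. 309 factor for an arbitrary law: only a tail bound is needed -/

section General

variable (χ : CutoffProfile) {Ω : Type*} [MeasurableSpace Ω]

/-- **p. 309, integration against an arbitrary law.**  For `n ≥ 1` there is `C = C(χ,p,n) ≥ 0` such that for every finite measure μ on Ω,
every measurable real observable Φ, all `c ≠ 0`, `0 < e_k`, `0 < t`, `te_k ≤ e^{−1}`:
`∫ |(d/dt)ⁿ χ(c·p(te_k), Φ(ω))| dμ(ω) ≤ C · t^{−n} · μ{ω : (9/10)|c|p(te_k) ≤ |Φ(ω)|}`. [cite: BalabanImbrieJaffe1988, (5.14.4) p.309] -/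
theorem integral_abs_iteratedDeriv_cutoff_t_le_measureReal (p : ℝ) {n : ℕ} (hn : 1 ≤ n) :
    ∃ C : ℝ, 0 ≤ C ∧ ∀ (μ : Measure Ω) [IsFiniteMeasure μ] (Φ : Ω → ℝ), Measurable Φ →
      ∀ ⦃c ek t : ℝ⦄, c ≠ 0 → 0 < ek → 0 < t → t * ek ≤ Real.exp (-1) →
        ∫ ω, |iteratedDeriv n (fun s => cutoff χ (c * pLog p (s * ek)) (Φ ω)) t| ∂μ ≤
          C * t ^ (-(n : ℤ)) * μ.real {ω | 9 / 10 * (|c| * pLog p (t * ek)) ≤ |Φ ω|} := by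
  obtain ⟨C, hC0, hC⟩ := BIJ88ChiTDerivN309.exists_abs_iteratedDeriv_cutoff_t_le_indicator χ p hn
  refine ⟨C, hC0, ?_⟩
  intro μ _ Φ hΦ c ek t hc hek ht h1
  set a : ℝ := 9 / 10 * (|c| * pLog p (t * ek)) with ha
  set S : Set Ω := {ω | a ≤ |Φ ω|} with hS
  have hSm : MeasurableSet S := measurableSet_le measurable_const hΦ.abs
  have htz : 0 ≤ t ^ (-(n : ℤ)) := (zpow_pos ht _).le
  set K : ℝ := t ^ (-(n : ℤ)) * C with hK
  have hK0 : 0 ≤ K := mul_nonneg htz hC0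
  have hpt : ∀ ω, |iteratedDeriv n (fun s => cutoff χ (c * pLog p (s * ek)) (Φ ω)) t| ≤ S.indicator (fun _ => K) ω := by
    intro ω
    refine (hC (Φ ω) hc hek ht h1).trans ?_
    by_cases hω : ω ∈ S
    · rw [Set.indicator_of_mem hω]
      refine mul_le_mul_of_nonneg_left ?_ htz
      rcases Set.indicator_eq_zero_or_self (Set.Icc (9 / 10 * (|c| * pLog p (t * ek))) (|c| * pLog p (t * ek)))
        (fun _ => (1 : ℝ)) |Φ ω| with h | h
      · rw [h, mul_zero]; exact hC0
      · rw [h, mul_one]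
    · have hω' : |Φ ω| ∉ Set.Icc (9 / 10 * (|c| * pLog p (t * ek))) (|c| * pLog p (t * ek)) := fun h => hω h.1
      rw [Set.indicator_of_notMem hω, Set.indicator_of_notMem hω', mul_zero, mul_zero]
  have hint : Integrable (S.indicator fun _ => K) μ := (integrable_const K).indicator hSm
  calc ∫ ω, |iteratedDeriv n (fun s => cutoff χ (c * pLog p (s * ek)) (Φ ω)) t| ∂μ
      ≤ ∫ ω, S.indicator (fun _ => K) ω ∂μ :=
        integral_mono_of_nonneg (Filter.Eventually.of_forall fun ω => abs_nonneg _) hint (Filter.Eventually.of_forall hpt)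
    _ = μ.real S * K := by rw [integral_indicator_const K hSm, smul_eq_mul]
    _ = C * t ^ (-(n : ℤ)) * μ.real S := by rw [hK]; ring

end General

/-! ## §2 The complex scalar field: `φ = X + iY`, two independent centered Gaussians (model instance) -/

section Complex

/-- `|x + iy| = √(x² + y²)`: the observable below is the modulus of the complex field value. [cite: BalabanImbrieJaffe1988, (5.14.4) p.309] -/
theorem norm_mk_eq_sqrt (x y : ℝ) : ‖(x : ℂ) + y * Complex.I‖ = Real.sqrt (x ^ 2 + y ^ 2) :=
  Complex.norm_add_mul_I x y

/-- The modulus tail splits into coordinate tails: `{a ≤ √(x²+y²)} ⊆ {a/√2 ≤ |x|} × ℝ ∪ ℝ × {a/√2 ≤ |y|}`.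
[cite: BalabanImbrieJaffe1988, (5.14.4) p.309] -/
theorem sqrt_sq_add_sq_tail_subset (a : ℝ) :
    {q : ℝ × ℝ | a ≤ Real.sqrt (q.1 ^ 2 + q.2 ^ 2)} ⊆
      ({x : ℝ | a / Real.sqrt 2 ≤ |x|} ×ˢ Set.univ) ∪ (Set.univ ×ˢ {y : ℝ | a / Real.sqrt 2 ≤ |y|}) := by
  rintro ⟨x, y⟩ hq
  simp only [Set.mem_setOf_eq] at hq
  by_contra hnot
  simp only [Set.mem_union, Set.mem_prod, Set.mem_univ, Set.mem_setOf_eq, and_true, true_and, not_or, not_le] at hnot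
  obtain ⟨hx, hy⟩ := hnot
  have h2 : 0 < Real.sqrt 2 := Real.sqrt_pos.mpr (by norm_num)
  have hsq2 : Real.sqrt 2 ^ 2 = 2 := Real.sq_sqrt (by norm_num)
  have ha : 0 < a := by
    by_contra ha
    have : a / Real.sqrt 2 ≤ 0 := div_nonpos_of_nonpos_of_nonneg (not_lt.mp ha) h2.le
    linarith [abs_nonneg x]
  -- |x| < a/√2 and |y| < a/√2 give x² + y² < a², contradicting a ≤ √(x² + y²)
  have hx2 : x ^ 2 < a ^ 2 / 2 := by
    have h := abs_lt.mp (lt_of_lt_of_le hx le_rfl)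
    have hb : 0 ≤ a / Real.sqrt 2 := by positivity
    have : |x| ^ 2 < (a / Real.sqrt 2) ^ 2 := by
      exact pow_lt_pow_left₀ hx (abs_nonneg x) two_ne_zero
    rw [sq_abs, div_pow, hsq2] at this
    exact this
  have hy2 : y ^ 2 < a ^ 2 / 2 := by
    have : |y| ^ 2 < (a / Real.sqrt 2) ^ 2 := pow_lt_pow_left₀ hy (abs_nonneg y) two_ne_zero
    rw [sq_abs, div_pow, hsq2] at this
    exact this
  have hlt : Real.sqrt (x ^ 2 + y ^ 2) < a := by
    rw [Real.sqrt_lt' ha]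
    linarith
  linarith

/-- **Tail of the modulus of a centered complex Gaussian (model instance: two independent real Gaussians of variance v)**:
`γ{a ≤ √(X²+Y²)} ≤ 4e^{−a²/(4v)}` for `a ≥ 0`. [cite: BalabanImbrieJaffe1988, (5.14.4) p.309] -/
theorem gaussian2_real_norm_ge_le (v : ℝ≥0) {a : ℝ} (ha : 0 ≤ a) :
    ((gaussianReal 0 v).prod (gaussianReal 0 v)).real {q : ℝ × ℝ | a ≤ Real.sqrt (q.1 ^ 2 + q.2 ^ 2)} ≤
      4 * Real.exp (-(a ^ 2 / (4 * v))) := by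
  set γ := gaussianReal 0 v with hγ
  set T : Set ℝ := {x : ℝ | a / Real.sqrt 2 ≤ |x|} with hT
  have hsq2 : Real.sqrt 2 ^ 2 = 2 := Real.sq_sqrt (by norm_num)
  have ha' : |(0 : ℝ)| ≤ a / Real.sqrt 2 := by rw [abs_zero]; positivity
  -- one-dimensional tail, read at mean 0
  have h1 : γ.real T ≤ 2 * Real.exp (-(a ^ 2 / (4 * v))) := by
    have h := gaussianReal_real_abs_ge_le 0 v ha'
    have hexp : -(a / Real.sqrt 2 - |(0 : ℝ)|) ^ 2 / (2 * (v : ℝ)) = -(a ^ 2 / (4 * v)) := by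
      rw [abs_zero, sub_zero, div_pow, hsq2]
      ring
    rw [hexp] at h
    exact h
  have hprod : ∀ s : Set ℝ, (γ.prod γ).real (s ×ˢ Set.univ) = γ.real s ∧ (γ.prod γ).real (Set.univ ×ˢ s) = γ.real s := by
    intro s
    constructor
    · rw [measureReal_def, Measure.prod_prod, measure_univ, mul_one, ← measureReal_def]
    · rw [measureReal_def, Measure.prod_prod, measure_univ, one_mul, ← measureReal_def]
  calc (γ.prod γ).real {q : ℝ × ℝ | a ≤ Real.sqrt (q.1 ^ 2 + q.2 ^ 2)}
      ≤ (γ.prod γ).real ((T ×ˢ Set.univ) ∪ (Set.univ ×ˢ T)) := measureReal_mono (sqrt_sq_add_sq_tail_subset a)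
    _ ≤ (γ.prod γ).real (T ×ˢ Set.univ) + (γ.prod γ).real (Set.univ ×ˢ T) := measureReal_union_le _ _
    _ = γ.real T + γ.real T := by rw [(hprod T).1, (hprod T).2]
    _ ≤ 2 * Real.exp (-(a ^ 2 / (4 * v))) + 2 * Real.exp (-(a ^ 2 / (4 * v))) := add_le_add h1 h1
    _ = 4 * Real.exp (-(a ^ 2 / (4 * v))) := by ring

variable (χ : CutoffProfile)

/-- **p. 309, "Similar bounds hold for φ^{(k)}" (model instance).**  For `n ≥ 1` there is `C = C(χ,p,n) ≥ 0` with
`∫ |(d/dt)ⁿ χ(c·p(te_k), |φ|)| dγ(φ) ≤ (4C)/tⁿ · e^{−((81/400)c²/v)·p(te_k)²}` for the centered complex Gaussian model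
`φ = X + iY` (X, Y independent of variance v), all `c ≠ 0`, `0 < e_k`, `0 < t`, `te_k ≤ e^{−1}` — the printed `ct^{−n}e^{−cp(te_k)²}`
for the scalar field. [cite: BalabanImbrieJaffe1988, (5.14.4) p.309] -/
theorem exists_integral_abs_iteratedDeriv_cutoff_t_phi_le (p : ℝ) {n : ℕ} (hn : 1 ≤ n) :
    ∃ C : ℝ, 0 ≤ C ∧ ∀ (v : ℝ≥0) ⦃c ek t : ℝ⦄, c ≠ 0 → 0 < ek → 0 < t → t * ek ≤ Real.exp (-1) →
      ∫ q, |iteratedDeriv n (fun s => cutoff χ (c * pLog p (s * ek)) (Real.sqrt (q.1 ^ 2 + q.2 ^ 2))) t|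
          ∂((gaussianReal 0 v).prod (gaussianReal 0 v)) ≤
        4 * C / t ^ n * Real.exp (-(81 / 400 * c ^ 2 / v * pLog p (t * ek) ^ 2)) := by
  obtain ⟨C, hC0, hC⟩ := integral_abs_iteratedDeriv_cutoff_t_le_measureReal (Ω := ℝ × ℝ) χ p hn
  refine ⟨C, hC0, fun v c ek t hc hek ht h1 => ?_⟩
  have hΦ : Measurable fun q : ℝ × ℝ => Real.sqrt (q.1 ^ 2 + q.2 ^ 2) :=
    Real.continuous_sqrt.measurable.comp ((measurable_fst.pow_const 2).add (measurable_snd.pow_const 2))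
  have h := hC ((gaussianReal 0 v).prod (gaussianReal 0 v)) (fun q : ℝ × ℝ => Real.sqrt (q.1 ^ 2 + q.2 ^ 2)) hΦ hc hek ht h1
  have hP : 0 ≤ |c| * pLog p (t * ek) := mul_nonneg (abs_nonneg c) (Real.rpow_nonneg (abs_nonneg _) p)
  have ha : 0 ≤ 9 / 10 * (|c| * pLog p (t * ek)) := by positivity
  -- the event {a ≤ |√(…)|} is the event {a ≤ √(…)}
  have hset : {ω : ℝ × ℝ | 9 / 10 * (|c| * pLog p (t * ek)) ≤ |Real.sqrt (ω.1 ^ 2 + ω.2 ^ 2)|} =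
      {q : ℝ × ℝ | 9 / 10 * (|c| * pLog p (t * ek)) ≤ Real.sqrt (q.1 ^ 2 + q.2 ^ 2)} := by
    ext q
    simp only [Set.mem_setOf_eq, abs_of_nonneg (Real.sqrt_nonneg _)]
  rw [hset] at h
  have htail := gaussian2_real_norm_ge_le v ha
  have htz : 0 ≤ C * t ^ (-(n : ℤ)) := mul_nonneg hC0 (zpow_pos ht _).le
  refine h.trans ((mul_le_mul_of_nonneg_left htail htz).trans (le_of_eq ?_))
  have : -((9 / 10 * (|c| * pLog p (t * ek))) ^ 2 / (4 * (v : ℝ))) = -(81 / 400 * c ^ 2 / v * pLog p (t * ek) ^ 2) := by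
    rw [mul_pow, mul_pow, sq_abs]
    ring
  rw [this, zpow_neg, zpow_natCast]
  ring

/-- **The whole sentence for φ^{(k)}** (model instance as above, charge reading of e^β): chained with `BIJ88GaussFactor309.gauss309`,
`∫ |(d/dt)ⁿ χ(c·p(te_k), |φ|)| dγ ≤ (e^β s^{1/4−α})ⁿ` with `L^kε = sε₀`, under that theorem's printed regime
(`n + 1 ≤ ((81/400)c²/v)|log e_k⁻¹|^{2p−1}`, `4C·e_k ≤ 1`, `e_k ≤ e^{−1}`, `0 < t ≤ 1`). [cite: BalabanImbrieJaffe1988, (5.14.4) p.309] -/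
theorem exists_integral_phi_le_vertexFactor_pow (p : ℝ) {n : ℕ} (hn : 1 ≤ n) :
    ∃ C : ℝ, 0 ≤ C ∧ ∀ (v : ℝ≥0) ⦃L ε e s ε₀ t c α β : ℝ⦄ ⦃d k : ℕ⦄, 0 < L → 0 < ε → 0 < e → e ≤ 1 → β ≤ 1 → 0 ≤ α → d < 4 →
      0 < s → s ≤ 1 → 0 < ε₀ → ε₀ ≤ 1 → L ^ k * ε = s * ε₀ → 0 < t → t ≤ 1 → 1 / 2 < p → c ≠ 0 →
      eK L ε e d k ≤ Real.exp (-1) →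
      (n : ℝ) + 1 ≤ 81 / 400 * c ^ 2 / v * Real.log (eK L ε e d k)⁻¹ ^ (2 * p - 1) → 4 * C * eK L ε e d k ≤ 1 →
        ∫ q, |iteratedDeriv n (fun σ => cutoff χ (c * pLog p (σ * eK L ε e d k)) (Real.sqrt (q.1 ^ 2 + q.2 ^ 2))) t|
            ∂((gaussianReal 0 v).prod (gaussianReal 0 v)) ≤
          (e ^ β * s ^ (1 / 4 - α)) ^ n := by
  obtain ⟨C, hC0, hC⟩ := exists_integral_abs_iteratedDeriv_cutoff_t_phi_le χ p hn
  refine ⟨C, hC0, ?_⟩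
  intro v L ε e s ε₀ t c α β d k hL hε he0 he1 hβ1 hα hd hs0 hs1 hε₀0 hε₀1 hLε ht0 ht1 hp hc hek1 hreg hsmall
  have hek : 0 < eK L ε e d k := BIJ88ScaleSums.eK_pos hL hε he0 k
  have h1 : t * eK L ε e d k ≤ Real.exp (-1) := (mul_le_of_le_one_left hek.le ht1).trans hek1
  refine (hC v hc hek ht0 h1).trans ?_
  exact BIJ88GaussFactor309.gauss309 hL hε he0 he1 hβ1 hα hd hs0 hs1 hε₀0 hε₀1 hLε ht0 ht1 hp (by positivity) (by positivity)
    hreg hsmall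

end Complex

end Literature.MathematicalPhysics.QuantumFieldTheory.BalabanImbrieJaffe1984to88.BIJ88GaussIntegration309Phi
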